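import Mathlib
import HarnessLib
import Summits.HubbardSuperconductivity.HubbardSuperconductivity.Theorems.KLProgrammeKLRegimeEngineTowerLevLawOfRowsFClosed
import Summits.HubbardSuperconductivity.HubbardSuperconductivity.Theorems.KLProgrammeKLRegimeEngineTowerLevBaseLaw
import Summits.HubbardSuperconductivity.HubbardSuperconductivity.Theorems.KLProgrammeKLRegimeEngineTowerLevBaseDisc

/-!
# Route `KLProgramme` — crux K3 ENGINE (stmt-HubbardSuperconductivity-20437 `KLRegimeEngineV17F2`), stub (b) v2, THE LEVELS PACKAGE (ℓ):
# «(ℓ)-BASE-F-DISC» — the base datum of the floor-keyed re-based law from a BI-GRADED weighted grid step, B-DISCOUNTED, and the (ℓ)-F law with it closed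
# (cell gate-hubbard-kl, seat hubbard-kl-k3c3-p2 g15; k3c2-p3's «(ℓ)-BASE-LEV» rows `klLevNormOf_le_of_wtPinned` (p668143) / `gridLaw_div_klLevUnitF_le` (p670020) +
#  k3c3-p2 g14's discount `pow_le_pow_div_sq` (…TowerLevBaseDisc, p670908) + the closed (I5)-F call `klTowerBLevF_le_law_lev_of_doors_of_le_B` (p674415))

The base of the re-based tower is `𝒱_d` read at `F_{d−1}`; p3's weighted grid step at `(Λ_d, F_{d−1})` (`…EngineCutoffKernelNormsWtAtFamily`,
`klWtPinnedSumAt_klEffectiveAction_fam_le_of_wgridStep`) delivers its weighted one-pinned sums with a degree budget `N_w(2p)` that is BI-GRADED: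
`N_w(2p) ≤ ε_x^{2p−1}·A_g·P_g^p·|U|^{p−1}` for `p ≥ 3` (one `|U|` per quartic vertex, `p − 1` vertices for `2p` legs).  The floor-keyed law's numerics need the
base in LAW shape `A_b·λ^{p−1}·Q_b^p` with `A_b ∝ B⁻²` and `Q_b` free of `λ = B·ε` (the amplitude rows are discharged by `B ≥ B₀`, …LawOfRowsFClosed).  Reading
`|U|^{p−1} ≤ (λ/(B·Klam))^{p−1} ≤ λ^{p−1}/(B·Klam)²` (`p ≥ 3`, `B·Klam ≥ 1`, `B·Klam·|U| ≤ λ`) gives exactly that: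

* §1 **`baseRowsF_of_wgrid_bigraded`** — from the grid datum: `N_b t p := N_w p` is nonnegative, dominates the levelled norms of `𝒱_d` at `F_{d−1}` at every level
  (`hcar`), and obeys the DISCOUNTED unit law `N_b t p / klLevUnitF … t p (d−1) ≤ (Â_b/B²)·λ^{p−1}·Q_b^p` (`p ≥ 3`) with `Â_b = 2^{7(d−1)}·A_g/Klam²`, `Q_b = P_g/8^{d−1}`;
* §2 **`klTowerBLevF_le_law_lev_of_doors_of_wgrid`** — `klTowerBLevF_le_law_lev_of_doors_of_le_B` with `hcar`/`hlawb` DISCHARGED: the floor-keyed levelled law at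
  `λ = B·ε_j` whose inputs are a bi-graded weighted grid datum at `(Λ_d, F_{d−1})`, the imports `ι₁`, `ῑ₂/B`, the cell `X̄/B²`, the floor LINK `hstep`, and the
  numerical rows: blocking (choice of `d`), `B ≥ B₀`, the two doors;
* §3 `wgridBudget_bigraded_le` — p3's literal degree budget (`hNp` of `…CutoffKernelNormsWtAtFamily`) IS bi-graded: the explicit `A_g, P_g` (pure algebra).
Compositions of landed theorems and real algebra; nothing about the model is asserted beyond them; nothing asserts (ℓ), any stub, K3 or superconductivity.
References: BGM 2006 §2.8 (2.83), (2.93)–(2.98), Lemma 2.5 [cite: BenfattoGiulianiMastropietro2006].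
-/

noncomputable section

namespace Summit.HubbardSuperconductivity.HubbardSuperconductivity.Theorems.EngineV8

set_option linter.dupNamespace false -- summit = problem name (single-conjunct summit), D-0017

open Classical
open Real Finset Literature.MathematicalPhysics.QuantumLattice Literature.Probability.LatticeModels GrassmannAlgebra
open Literature.MathematicalPhysics.QuantumLattice.FermiRG
open Summit.HubbardSuperconductivity.HubbardSuperconductivity.Theorems.KLProgrammeLegKernels
open Summit.HubbardSuperconductivity.HubbardSuperconductivity.Theorems.KLRegimeSplit
open Summit.HubbardSuperconductivity.HubbardSuperconductivity.Theorems.KLRegimeWick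
open Summit.HubbardSuperconductivity.HubbardSuperconductivity.Theorems.TorusFourierL2
open Summit.HubbardSuperconductivity.HubbardSuperconductivity.Theorems.DispersionFlow

variable {L M : ℕ} [NeZero L] [NeZero M]

/-! ## §1 The discounted base rows from a bi-graded weighted grid datum -/

/-- **THE BASE ROWS OF THE FLOOR-KEYED LAW FROM A BI-GRADED WEIGHTED GRID DATUM, B-DISCOUNTED.**  Let the weighted one-pinned sums of `𝒱_d` at `F_{d−1}`
(rate `j`) be bounded by a degree budget, `klWtPinnedSumAt … (d−1) j (2p) 𝒱_d q w ≤ N_w p` (`p ≥ 1`, `N_w ≥ 0`), bi-graded above degree six: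
`N_w p ≤ ε_x^{2p−1}·A_g·P_g^p·|U|^{p−1}` (`p ≥ 3`; `A_g, P_g ≥ 0`).  Then for `B·Klam ≥ 1` and `B·Klam·|U| ≤ λ`, the array `N_b t p := N_w p` satisfies the three base
hypotheses of `klTowerBLevF_le_law_of_base_rows`: nonnegativity, `hcar` (every levelled norm of level `t+1` in degree `2p` is `≤ N_b t p`), and the unit law
`N_b t p / klLevUnitF … t p (d−1) ≤ (2^{7(d−1)}·A_g/Klam²/B²)·λ^{p−1}·(P_g/8^{d−1})^p` (`p ≥ 3`). [cite: BenfattoGiulianiMastropietro2006, §2.8 (2.83), (2.93)-(2.98)] -/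
theorem baseRowsF_of_wgrid_bigraded {β : ℝ} (hβ : 0 < β) (U μ : ℝ) (K : TrigPolyC4v) (d j : ℕ) (Nw : ℕ → ℝ) (hNw0 : ∀ p, 0 ≤ Nw p)
    (hgrid : ∀ p, 1 ≤ p → ∀ (q : Fin (2 * p)) (w : SpaceTimeIdx L M × SectorLeg (sectorCount (d - 1))),
      klWtPinnedSumAt L M β μ K (d - 1) j (2 * p) (klTowerInput L M β U μ K d 1) q w ≤ Nw p)
    {Ag Pg : ℝ} (hAg : 0 ≤ Ag) (hPg : 0 ≤ Pg)
    (hbi : ∀ p, 3 ≤ p → Nw p ≤ imagTimeWeight β M ^ (2 * p - 1) * Ag * Pg ^ p * |U| ^ (p - 1))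
    {B Klam lam : ℝ} (hK : 0 < Klam) (hBK : 1 ≤ B * Klam) (hle : B * Klam * |U| ≤ lam) :
    (∀ (t : Fin 5) (p : ℕ), 0 ≤ (fun (_ : Fin 5) (p : ℕ) => Nw p) t p) ∧
    (∀ (t : Fin 5) (p : ℕ) (Ωe' : Fin (2 * p) → Option (SectorLeg (sectorCount (d - 1)))), levelCount Ωe' = (t : ℕ) + 1 →
      klLevNormOf L M β μ K (d - 1) (2 * p) (klTowerInput L M β U μ K d 1) Ωe' ≤ (fun (_ : Fin 5) (p : ℕ) => Nw p) t p) ∧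
    (∀ (t : Fin 5) (p : ℕ), 3 ≤ p → (fun (_ : Fin 5) (p : ℕ) => Nw p) t p / klLevUnitF β M t p (d - 1) ≤
      ((2 : ℝ) ^ (7 * (d - 1)) * Ag / Klam ^ 2 / B ^ 2) * lam ^ (p - 1) * (Pg / (8 : ℝ) ^ (d - 1)) ^ p) := by
  refine ⟨fun t p => hNw0 p, fun t p Ωe' hlev => ?_, fun t p hp => ?_⟩
  · -- `hcar`: every prescription is dominated by the common bound of the weighted pinned sums (degree `0` carries no prescription of positive level)
    have hle' : levelCount Ωe' ≤ 2 * p := by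
      unfold levelCount
      exact (Finset.card_filter_le _ _).trans (by rw [Finset.card_univ, Fintype.card_fin])
    rcases Nat.eq_zero_or_pos p with hp0 | hp0
    · exfalso; omega
    · exact klLevNormOf_le_of_wtPinned hβ.le μ K (d - 1) j (klTowerInput L M β U μ K d 1) (by omega) Ωe' (hNw0 p) (hgrid p hp0)
  · -- `hlawb`: unit law of the bi-graded budget, then the discount `|U|^{p−1} ≤ λ^{p−1}/(B·Klam)²`
    have hε : 0 < imagTimeWeight β M := by
      unfold imagTimeWeight
      have : (0 : ℝ) < M := Nat.cast_pos.2 (Nat.pos_of_ne_zero (NeZero.ne M))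
      positivity
    have hu : 0 < klLevUnitF β M t p (d - 1) := klLevUnitF_pos hβ t p _
    have hU0 : 0 ≤ |U| := abs_nonneg U
    have hAU : 0 ≤ Ag * |U| ^ (p - 1) := by positivity
    have hBK0 : 0 < B * Klam := lt_of_lt_of_le one_pos hBK
    have hB0 : 0 < B := by
      have h := div_pos hBK0 hK
      rwa [mul_div_assoc, div_self hK.ne', mul_one] at h
    calc Nw p / klLevUnitF β M t p (d - 1)
        ≤ imagTimeWeight β M ^ (2 * p - 1) * (Ag * |U| ^ (p - 1)) * Pg ^ p / klLevUnitF β M t p (d - 1) := by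
          refine div_le_div_of_nonneg_right ((hbi p hp).trans (le_of_eq (by ring))) hu.le
      _ ≤ ((2 : ℝ) ^ (7 * (d - 1)) * (Ag * |U| ^ (p - 1)) * 1) * (1 : ℝ) ^ (p - 1) * (Pg / ((8 : ℝ) ^ (d - 1) * 1)) ^ p :=
          gridLaw_div_klLevUnitF_le hβ hAU hPg one_pos t (by omega) (d - 1)
      _ = (2 : ℝ) ^ (7 * (d - 1)) * Ag * (Pg / (8 : ℝ) ^ (d - 1)) ^ p * |U| ^ (p - 1) := by rw [one_pow, mul_one, mul_one, mul_one]; ring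
      _ ≤ (2 : ℝ) ^ (7 * (d - 1)) * Ag * (Pg / (8 : ℝ) ^ (d - 1)) ^ p * (lam ^ (p - 1) / (B * Klam) ^ 2) :=
          mul_le_mul_of_nonneg_left (pow_le_pow_div_sq hU0 hBK hle hp) (by positivity)
      _ = ((2 : ℝ) ^ (7 * (d - 1)) * Ag / Klam ^ 2 / B ^ 2) * lam ^ (p - 1) * (Pg / (8 : ℝ) ^ (d - 1)) ^ p := by
          field_simp

/-! ## §2 The floor-keyed law with the base datum, the amplitudes and the block-1 profile closed -/

/-- **THE FLOOR-KEYED RE-BASED LEVELLED TOWER LAW FROM A BI-GRADED WEIGHTED GRID DATUM** (doors form, `λ = B·ε_j`, amplitudes by `B ≥ B₀`): the inputs are a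
weighted grid datum of `𝒱_d` at `F_{d−1}` (`N_w`, bi-graded with `A_g, P_g`), the imports `ι₁`, `ῑ₂/B`, the cell `X̄/B²`, the floor LINK `hstep`, and the numerical
rows BLOCKING (choice of `d`), `B ≥ B₀`, the U-door and the c-door; the explicit choices are equational binders (`Â_b = 2^{7(d−1)}·A_g/Klam²`, `Q_b = P_g/8^{d−1}`,
`A_b′ = Â_b/B²`, …). [cite: BenfattoGiulianiMastropietro2006, §2.8 (2.83), (2.93)-(2.98)] -/
theorem klTowerBLevF_le_law_lev_of_doors_of_wgrid :
    ∃ C₁ C₂ : ℝ, 0 < C₁ ∧ 0 < C₂ ∧ ∀ R : RenConsts, R.WF2 → ∃ c₃' : ℝ, 0 < c₃' ∧ ∃ U₀' : ℝ, 0 < U₀' ∧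
      ∀ (P : SplitConsts) (c : ℝ), P.WF → 0 < c → c ≤ klEngC₃6 P R → c ≤ c₃' →
      ∀ μ ∈ klWindowC, ∀ U : ℝ, 0 < U → U ≤ klEngU₀9 P R c → U ≤ U₀' → ∀ β : ℝ, klBetaMin ≤ β → β ≤ Real.exp (c / U ^ 2) →
      ∀ K : TrigPolyC4v, FrameOK R U (nScales β) μ K → ∀ (L M : ℕ) [NeZero L] [NeZero M],
      klEngL₃ β U ≤ L → klEngM₃ β U L ≤ M → ∀ d Kb D : ℕ, 2 ≤ d → d * Kb - 1 ≤ nScales β + 1 → 3 ≤ D →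
      ∀ (cc : ℝ) (n j : ℕ), IsKLRegime U cc (-(n : ℤ)) → j ≤ n →
      ∀ (B : ℝ), 1 ≤ B →
      -- the bi-graded weighted grid datum of `𝒱_d` at `F_{d−1}` (p3's step at `(Λ_d, F_{d−1})`, rate `jw`)
      ∀ (jw : ℕ) (Nw : ℕ → ℝ), (∀ p, 0 ≤ Nw p) →
        (∀ p, 1 ≤ p → ∀ (q : Fin (2 * p)) (w : SpaceTimeIdx L M × SectorLeg (sectorCount (d - 1))),
          klWtPinnedSumAt L M β μ K (d - 1) jw (2 * p) (klTowerInput L M β U μ K d 1) q w ≤ Nw p) →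
      ∀ (Ag Pg : ℝ), 0 < Ag → 0 ≤ Pg →
        (∀ p, 3 ≤ p → Nw p ≤ imagTimeWeight β M ^ (2 * p - 1) * Ag * Pg ^ p * |U| ^ (p - 1)) →
      ∀ (ι₂ X : ℝ), 0 ≤ ι₂ → 0 ≤ X →
      -- the base constants and the B-discounted data (equational binders)
      ∀ (Ab Qb Ab' ι₂' X' : ℝ), Ab = (2 : ℝ) ^ (7 * (d - 1)) * Ag / P.Klam ^ 2 → Qb = Pg / (8 : ℝ) ^ (d - 1) →
        Ab' = Ab / B ^ 2 → ι₂' = ι₂ / B → X' = X / B ^ 2 →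
      ∀ (W Z σ Φ ψ τ ι₁ : ℝ), 0 < W → 0 < Z → 0 ≤ σ → 0 ≤ Φ → 0 ≤ ψ → 0 < τ → 0 ≤ ι₁ →
      -- the explicit (I5)-F choices (equational binders) and the B-free `Ȳ`
      ∀ (ρ Q' Q κ Yb Y A A' ι₃ : ℝ), ρ = max 4 (2 * τ * ψ) → Q' = Z * Qb + 1 → Q = ρ * Q' →
        κ = W * ((27 : ℝ) ^ 5 * (C₁ / C₂) * (8 : ℝ) ^ (d - 1)) →
        Yb = ι₂ / (2 * Q') + W * Z ^ 3 * X / (4 * Q' ^ 2) + (W * (27 : ℝ) ^ 5 * Ab + κ * Ab) * Q' / 2 →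
        Y = ι₂' / (2 * Q') + W * Z ^ 3 * X' / (4 * Q' ^ 2) + (W * (27 : ℝ) ^ 5 * Ab' + κ * Ab') * Q' / 2 →
        A = 2 * Y * (1 - ((2 : ℝ) ^ d)⁻¹) / (κ * Q') →
        A' = (W * (27 : ℝ) ^ 5 * Ab' + κ * Ab') + 2 * Y / Q' → ι₃ = W * Z ^ 3 * X' + A' * Q' ^ 3 →
      -- the BLOCKING row (choice of `d`) and `B ≥ B₀` (the two amplitude rows)
      max 1 Z * C₂ ^ 2 * max 4 (2 * τ * ψ) ≤ (2 : ℝ) ^ (d - 1) →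
      max 1 (max (8 * Φ * τ * Yb) (128 * exp 1 * ψ ^ 3 * τ ^ 4 * Φ * κ * Yb / ((1 - ((2 : ℝ) ^ d)⁻¹) * ρ ^ 3))) ≤ B →
      -- the imports (E1 (I4)) and the located cell, in the discounted shapes, at `λ = B·ε_j`
      (∀ k, 1 ≤ k → k < Kb → W * Z ^ 1 * klTowerMuLevF L M β U μ K d k 1 ≤ ι₁ * (B * epsCoupling P U j)) →
      (∀ k, 1 ≤ k → k < Kb → W * Z ^ 2 * klTowerMuLevF L M β U μ K d k 2 ≤ ι₂' * (B * epsCoupling P U j)) →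
      (∀ k, 2 ≤ k → k < Kb → klTowerMuLevAtF L M β U μ K d 0 k 3 ≤ X' * (B * epsCoupling P U j) ^ 2) →
      -- the floor step at blocks `k ≥ 1` (the «(I1)-LEV-FLOOR» LINK)
      (∀ t : Fin 5, ∀ k, 1 ≤ k → k < Kb → ∀ N : ℕ, 2 ≤ N → ∀ p, 3 ≤ p → p ≤ D →
        Φ * towerV D τ (fun m => W * Z ^ m * klTowerMuLevF L M β U μ K d k m) < 1 →
        klTowerBLevF L M β U μ K d t (k + 1) p ≤
          towerFO D σ (fun m => W * Z ^ m * klTowerMuLevF L M β U μ K d k m) p +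
            ∑ n ∈ Icc 2 N, exp 1 * Φ ^ (n - 1) * ψ ^ p * towerS D τ (fun m => W * Z ^ m * klTowerMuLevF L M β U μ K d k m) n p +
            ψ ^ p * exp 1 * towerV D τ (fun m => W * Z ^ m * klTowerMuLevF L M β U μ K d k m) *
              (Φ * towerV D τ (fun m => W * Z ^ m * klTowerMuLevF L M β U μ K d k m)) ^ N /
              (1 - Φ * towerV D τ (fun m => W * Z ^ m * klTowerMuLevF L M β U μ K d k m))) →
      -- the two doors
      U ≤ min 1 (min (1 / (8 * σ * Q' + 1)) (min (1 / (2 * exp 1 * τ * Q' + 1)) (min (1 / (4 * Φ * τ * ι₁ + 1))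
        (min (1 / (2 * (Φ * (exp 1 * τ * ι₁ + (exp 1 * τ) ^ 2 * ι₂' + (exp 1 * τ) ^ 3 * ι₃ + A' * (exp 1 * τ * Q') ^ 2 / 2)) + 1))
          (min (A * Q ^ 3 / (16 * σ * Q' * A' * (4 * Q') ^ 3 + A * Q ^ 3))
            (A * Q ^ 3 / (16 * exp 1 * ψ * (2 * τ * ψ * Q') ^ 2 * Φ * τ ^ 2 * ι₁ ^ 2 + A * Q ^ 3))))))) / (2 * B * P.Klam + 1) →
      cc ≤ min 1 (min (1 / (8 * σ * Q' + 1)) (min (1 / (2 * exp 1 * τ * Q' + 1)) (min (1 / (4 * Φ * τ * ι₁ + 1))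
        (min (1 / (2 * (Φ * (exp 1 * τ * ι₁ + (exp 1 * τ) ^ 2 * ι₂' + (exp 1 * τ) ^ 3 * ι₃ + A' * (exp 1 * τ * Q') ^ 2 / 2)) + 1))
          (min (A * Q ^ 3 / (16 * σ * Q' * A' * (4 * Q') ^ 3 + A * Q ^ 3))
            (A * Q ^ 3 / (16 * exp 1 * ψ * (2 * τ * ψ * Q') ^ 2 * Φ * τ ^ 2 * ι₁ ^ 2 + A * Q ^ 3))))))) * Real.log 4 / (2 * B * P.Klam + 1) →
      ∀ k, 2 ≤ k → k ≤ Kb → ∀ (t : Fin 5) (p : ℕ), 3 ≤ p → p ≤ D →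
        klTowerBLevF L M β U μ K d t k p ≤ A * (B * epsCoupling P U j) ^ (p - 1) * Q ^ p := by
  obtain ⟨C₁, C₂, hC₁, hC₂, h⟩ := klTowerBLevF_le_law_lev_of_doors_of_le_B
  refine ⟨C₁, C₂, hC₁, hC₂, fun R hR2 => ?_⟩
  obtain ⟨c₃, hc₃, U₀, hU₀, h'⟩ := h R hR2
  refine ⟨c₃, hc₃, U₀, hU₀, ?_⟩
  intro P c hP hc hc6 hc₃' μ hμ U hU hU9 hU₀' β hβmin hβc K hK L M _ _ hL3 hM3 d Kb D hd hKbN hD cc n j hreg hj B hB jw Nw hNw0 hgrid Ag Pg hAg hPg hbi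
    ι₂ X hι₂ hX Ab Qb Ab' ι₂' X' hAb hQb hAb' hι₂' hX' W Z σ Φ ψ τ ι₁ hW hZ hσ hΦ hψ hτ hι₁ ρ Q' Q κ Yb Y A A' ι₃ hρ hQ' hQ hκ hYb hY hA hA' hι₃
    hblock hBle himp₁ himp₂ hcell hstep hUdoor hcdoor
  have hβ : 0 < β := KLRegimeSplit.pos_of_klBetaMin_le hβmin
  have hK1 : 1 ≤ P.Klam := hP.1
  have hK0 : 0 < P.Klam := lt_of_lt_of_le one_pos hK1
  have hB0 : 0 < B := lt_of_lt_of_le one_pos hB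
  have hBK : 1 ≤ B * P.Klam := one_le_mul_of_one_le_of_one_le hB hK1
  have hle : B * P.Klam * |U| ≤ B * epsCoupling P U j := by
    unfold epsCoupling
    have h1 : |U| ≤ |U| + U ^ 2 * (j : ℝ) := le_add_of_nonneg_right (by positivity)
    calc B * P.Klam * |U| = B * (P.Klam * |U|) := by ring
      _ ≤ B * (P.Klam * (|U| + U ^ 2 * (j : ℝ))) := mul_le_mul_of_nonneg_left (mul_le_mul_of_nonneg_left h1 hK0.le) hB0.le
  have hAb0 : 0 < Ab := by rw [hAb]; positivity
  have hQb0 : 0 ≤ Qb := by rw [hQb]; positivity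
  obtain ⟨hNb0, hcar, hlawb⟩ := baseRowsF_of_wgrid_bigraded hβ U μ K d jw Nw hNw0 hgrid hAg.le hPg hbi hK0 hBK hle
  have hlawb' : ∀ (t : Fin 5) (p : ℕ), 3 ≤ p → (fun (_ : Fin 5) (p : ℕ) => Nw p) t p / klLevUnitF β M t p (d - 1) ≤
      Ab' * (B * epsCoupling P U j) ^ (p - 1) * Qb ^ p := by
    intro t p hp
    rw [hAb', hAb, hQb]
    exact hlawb t p hp
  exact h' P c hP hc hc6 hc₃' μ hμ U hU hU9 hU₀' β hβmin hβc K hK L M hL3 hM3 d Kb D hd hKbN hD cc n j hreg hj B Ab Qb ι₂ X hB hAb0 hQb0 hι₂ hX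
    Ab' ι₂' X' hAb' hι₂' hX' (fun (_ : Fin 5) (p : ℕ) => Nw p) hNb0 hcar hlawb' W Z σ Φ ψ τ ι₁ hW hZ hσ hΦ hψ hτ hι₁ ρ Q' Q κ Yb Y A A' ι₃
    hρ hQ' hQ hκ hYb hY hA hA' hι₃ hblock hBle himp₁ himp₂ hcell hstep hUdoor hcdoor

/-! ## §3 Reading a p3-type degree budget in the bi-graded form -/

/-- **THE WEIGHTED GRID STEP's DEGREE BUDGET IS BI-GRADED**: the degree-`2p` budget of `…EngineCutoffKernelNormsWtAtFamily` (`p ≥ 2`; its `hNp` entry without the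
`ε_x^{2p−1}` prefactor), `c_r·c_c^{2p−1}·(ρ^{−2p}·(e·f)·(e·α_w·f/κ²)^{p−2}/(1−θ)^p)` with `f = c_F·u` LINEAR in the coupling `u = |U|`
(`c_F = (e²(κ+ρ))⁴·|β|/(4M)`), is `≤ A_g·P_g^p·u^{p−1}` with the `u`-FREE `A_g = c_r·e·c_F/(c_c·c_g²)`, `P_g = c_c²·c_g/(ρ²(1−θ))`, `c_g = e·α_w·c_F/κ²` (equality for `c_c > 0`;
both sides vanish at `c_c = 0`) — the `hbi` input of `baseRowsF_of_wgrid_bigraded` / `klTowerBLevF_le_law_lev_of_doors_of_wgrid`.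
[cite: BenfattoGiulianiMastropietro2006, §2.8 (2.83), §3 (3.2)-(3.8)] -/
theorem wgridBudget_bigraded_le {crw ccw ρ κ αw θ f cF u : ℝ} (hccw : 0 ≤ ccw) (hρ : 0 < ρ) (hκ : 0 < κ)
    (hαw : 0 < αw) (hθ : θ < 1) (hcF : 0 < cF) (hf : f = cF * u) {p : ℕ} (hp : 2 ≤ p) :
    crw * ccw ^ (2 * p - 1) * (ρ⁻¹ ^ (2 * p) * (exp 1 * f) * (exp 1 * αw * f / κ ^ 2) ^ (p - 2) / (1 - θ) ^ p) ≤
      (crw * exp 1 * cF / (ccw * (exp 1 * αw * cF / κ ^ 2) ^ 2)) *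
        (ccw ^ 2 * (exp 1 * αw * cF / κ ^ 2) / (ρ ^ 2 * (1 - θ))) ^ p * u ^ (p - 1) := by
  obtain ⟨q, rfl⟩ : ∃ q, p = q + 2 := ⟨p - 2, by omega⟩
  obtain ⟨t, ht, rfl⟩ : ∃ t : ℝ, 0 < t ∧ θ = 1 - t := ⟨1 - θ, sub_pos.2 hθ, by ring⟩
  have he : 0 < exp 1 := exp_pos 1
  have h2 : 2 * (q + 2) - 1 = 2 * q + 3 := by omega
  have h3 : q + 2 - 2 = q := by omega
  have h4 : q + 2 - 1 = q + 1 := by omega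
  have hcgu : exp 1 * αw * (cF * u) / κ ^ 2 = (exp 1 * αw * cF / κ ^ 2) * u := by ring
  have hcg : 0 < exp 1 * αw * cF / κ ^ 2 := by positivity
  rw [h2, h3, h4, hf, sub_sub_cancel, hcgu]
  generalize exp 1 * αw * cF / κ ^ 2 = cg at hcg ⊢
  rcases eq_or_lt_of_le hccw with hccw0 | hccw0
  · -- degenerate column constant: both sides vanish
    rw [← hccw0]
    simp
  · refine le_of_eq ?_
    have hρ2 : ρ⁻¹ ^ (2 * (q + 2)) = ((ρ ^ 2) ^ (q + 2))⁻¹ := by rw [pow_mul, inv_pow, inv_pow]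
    rw [hρ2, mul_pow cg u q, div_pow, mul_pow (ccw ^ 2) cg (q + 2), mul_pow (ρ ^ 2) t (q + 2), ← pow_mul ccw 2 (q + 2)]
    have hρ0 : (ρ ^ 2) ^ (q + 2) ≠ 0 := by positivity
    have ht0 : t ≠ 0 := ht.ne'
    have hc0 : ccw ≠ 0 := hccw0.ne'
    have hcg0 : cg ≠ 0 := hcg.ne'
    have he0 : exp 1 ≠ 0 := he.ne'
    field_simp
    ring

end Summit.HubbardSuperconductivity.HubbardSuperconductivity.Theorems.EngineV8
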